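import Mathlib.Analysis.SpecialFunctions.Pow.Real
import Mathlib.Analysis.SpecialFunctions.Log.Base
import Mathlib.Analysis.SpecificLimits.Normed
import Mathlib.Analysis.Complex.ExponentialBounds
import Literature.Computability.Complexity.AverageCaseDepthHierarchy
import HarnessLib

/-!
# Proof of the top fan-in estimate `w₀ = 2^m ln 2 · (1 ± o(1))` (Rossman–Servedio–Tan 2015, §6)

This file discharges the named fact `rossmanServedioTan2015_w0_asymp` of
`Literature/Computability/Complexity/AverageCaseDepthHierarchy.lean`:

B. Rossman, R. A. Servedio, L.-Y. Tan, *An average-case depth hierarchy theorem for Boolean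
circuits*, FOCS 2015 / arXiv:1504.03398 [RossmanServedioTan2015], §6 (p. 15): "The estimates for
`t₁` and `q` given in Lemma 7.1 imply that `w₀ = 2^m ln(2) · (1 ± o_m(1))`", where (§6, eq. for
`w₀`) `w₀ :=` the smallest integer such that `(1 - t₁)^{q w₀} ≤ 1/2`, and Lemma 7.1 (p. 16, proved
in Appendix 12, p. 41): "There is a universal constant `c > 0` such that for `2 ≤ d ≤ c m / log m`,
we have that `t_k = q ± q^{1.1}` for all `k ∈ [d-1]`."

## The printed argument (App. 12, p. 41) and what is formalised

RST prove, by downward induction on `k = d-1, …, 1`, the invariant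
`|t_k q - p| ≤ (2m)^{d-1-k} λ` (eq. (25)), using `w = m 2^m / log e - [0,1)` and their Fact 5.3
(`(1 - 1/x)^x ≤ e^{-1} ≤ (1 - 1/x)^{x-1}`, `1 + x ≤ eˣ ≤ 1 + 2x` on `[0,1]`); the regime
`d ≤ c m / log m` is exactly what keeps `(2m)^{d} λ = o(p)`.  We run the same induction on
`u_j := t_{d-1-j} · q` (`rstTAux m j * rstQ m`) with the slightly more generous invariant
`|u_j - p| ≤ (4m)^j (λ + q³)` (`rstTAux_mul_rstQ_sub_rstP`): the additive `q³` absorbs the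
second-order terms `2p²` and `w p · u t` of the two Taylor estimates without needing a *lower* bound
on `λ`, and the ratio `4m` leaves room for the constants; the one-step estimate is
`rst_step_abstract` (hypotheses: `m ≥ 1`, `m q ≤ 1/4`, `λ + q³ ≤ B`, `B m 2^m ≤ 1/4`).  With
`c = 1/16` the regime gives `(4m)^{d-2} ≤ 2^{m/8}` (`m ≥ 4`), and `λ ≤ 4 m² 2^{-5m/4}` (from
`2^m ≤ w ≤ 2^{2m}`), so `(4m)^{d-2} (λ + q³) m 2^m ≤ 5 m³ 2^{-m/8} → 0`.  Finally, for
`0 < t₁ < 1` the defining set of `w₀` is the upper set `{n | n ≥ ln 2 / (q · (-ln (1 - t₁)))}`, so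
`w₀ = ⌈ln 2 / (q · (-ln(1 - t₁)))⌉₊` exactly (`rstW0_eq_ceil`), and `t ≤ -ln(1-t) ≤ t/(1-t)` turns
`|t₁ q - p| ≤ η p` into `|w₀ / (2^m ln 2) - 1| ≤ ε` (`rst_w0_abstract`).  The universal constant
produced is `c = 1/16`; the threshold `m₀(ε)` comes from `m³ / (2^{1/8})^m → 0`
(`tendsto_pow_const_div_const_pow_of_one_lt`).

## Lemma 7.1 itself

The same invariant also discharges the named fact `rossmanServedioTan2015_lem71` (Lemma 7.1 as
printed: "`t_k = q ± q^{1.1}` for all `k ∈ [d-1]` whenever `2 ≤ d ≤ c m / log m`"), with `c = 1/64`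
(`rossmanServedioTan2015_lem71_holds`, at the end of the file): the regime alone forces `m ≥ 128`,
`m ≤ 2^{m/128}` and `(4m)^{d-2} ≤ 2^{3m/64}`, so `|t_k - q| = |t_k q - p| / q ≤
(4m)^{d-2} (λ + q³) / q ≤ 2^{-41m/64} ≤ 2^{-0.55 m} = q^{1.1}` (RST, App. 12, p. 41: Lemma 7.1
"follows directly from [the invariant `|t_k q - p| ≤ (2m)^{d-1-k} λ`], using [the definitions of
`λ, q` and `w`] and the fact that `p = Θ(log w / w)`").

## Sources

* [RossmanServedioTan2015] arXiv:1504.03398, read via `lit read arxiv:1504.03398`: p. 13 (§5.1,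
  Facts 5.2–5.3, "`log` = log₂"), p. 15 (§6: `w`, `p`, `w₀`, the `w₀` estimate), p. 16 (§7.1:
  `λ`, `q`, `t_k`, Lemma 7.1), p. 41 (App. 12: proof of Lemma 7.1, invariant (25)).
-/

noncomputable section

namespace Literature.Computability.Complexity

open Filter
open _root_.Topology

/-! ### Elementary estimates (RST Fact 5.3 in the form used here) -/

/-- `(1 - t)^a ≤ e^{-a t}` for `t < 1`, `a ≥ 0` (from `ln(1 - t) ≤ -t`). [folklore] -/
theorem one_sub_rpow_le_exp_neg {t a : ℝ} (ht1 : t < 1) (ha : 0 ≤ a) :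
    (1 - t) ^ a ≤ Real.exp (-(a * t)) := by
  have h1t : 0 < 1 - t := by linarith
  rw [Real.rpow_def_of_pos h1t, Real.exp_le_exp]
  have hlog : Real.log (1 - t) ≤ -t := by
    have := Real.log_le_sub_one_of_pos h1t
    linarith
  have := mul_le_mul_of_nonneg_left hlog ha
  linarith [mul_comm (Real.log (1 - t)) a]

/-- `e^{-a t / (1 - t)} ≤ (1 - t)^a` for `t < 1`, `a ≥ 0` (from `ln(1 - t) ≥ 1 - 1/(1-t)`).
[folklore] -/
theorem exp_neg_le_one_sub_rpow {t a : ℝ} (ht1 : t < 1) (ha : 0 ≤ a) :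
    Real.exp (-(a * t / (1 - t))) ≤ (1 - t) ^ a := by
  have h1t : 0 < 1 - t := by linarith
  have hne : (1 - t) ≠ 0 := h1t.ne'
  rw [Real.rpow_def_of_pos h1t, Real.exp_le_exp]
  have hlog : -(t / (1 - t)) ≤ Real.log (1 - t) := by
    have h := Real.one_sub_inv_le_log_of_pos h1t
    have e : (1 : ℝ) - (1 - t)⁻¹ = -(t / (1 - t)) := by
      field_simp
      ring
    linarith
  have := mul_le_mul_of_nonneg_left hlog ha
  have e2 : -(a * t / (1 - t)) = a * (-(t / (1 - t))) := by ring
  linarith [mul_comm (Real.log (1 - t)) a]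

/-! ### The parameters `p, q, w, λ` -/

/-- `p > 0`. [cite: RossmanServedioTan2015, §6 (p. 15)] -/
theorem rstP_pos (m : ℕ) : 0 < rstP m := Real.rpow_pos_of_pos two_pos _

/-- `q > 0`. [cite: RossmanServedioTan2015, §7.1 (p. 16)] -/
theorem rstQ_pos (m : ℕ) : 0 < rstQ m := Real.rpow_pos_of_pos two_pos _

/-- `q² = p`. [cite: RossmanServedioTan2015, §7.1 (p. 16, `q := √p`)] -/
theorem rstQ_sq (m : ℕ) : rstQ m ^ 2 = rstP m := by
  unfold rstQ rstP
  rw [← Real.rpow_natCast, ← Real.rpow_mul (by norm_num : (0:ℝ) ≤ 2)]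
  congr 1
  push_cast
  ring

/-- `p · 2^m = 1`. [cite: RossmanServedioTan2015, §6 (p. 15, `p := 2^{-m}`)] -/
theorem rstP_mul_two_pow (m : ℕ) : rstP m * 2 ^ m = 1 := by
  unfold rstP
  rw [Real.rpow_neg (by norm_num), Real.rpow_natCast, inv_mul_cancel₀ (by positivity)]

/-- `p = e^{-m ln 2}`. [cite: RossmanServedioTan2015, §6 (p. 15)] -/
theorem rstP_eq_exp (m : ℕ) : rstP m = Real.exp (-(m * Real.log 2)) := by
  unfold rstP
  rw [Real.rpow_def_of_pos two_pos]
  congr 1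
  ring

/-- `w ≤ m 2^m ln 2`. [cite: RossmanServedioTan2015, §6 (p. 15, eq. for `w`)] -/
theorem rstW_le (m : ℕ) : (rstW m : ℝ) ≤ m * 2 ^ m * Real.log 2 := by
  have := Real.log_pos (by norm_num : (1:ℝ) < 2)
  unfold rstW
  exact Nat.floor_le (by positivity)

/-- `w > m 2^m ln 2 - 1`. [cite: RossmanServedioTan2015, §6 (p. 15) and App. 12 (p. 41)] -/
theorem rstW_gt (m : ℕ) : m * 2 ^ m * Real.log 2 - 1 < rstW m := by
  have := Nat.lt_floor_add_one ((m : ℝ) * 2 ^ m * Real.log 2)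
  unfold rstW
  linarith

/-- `λ ≥ 0`. [cite: RossmanServedioTan2015, §7.1 (p. 16)] -/
theorem rstLam_nonneg (m : ℕ) : 0 ≤ rstLam m := by
  unfold rstLam
  apply div_nonneg
  · apply Real.rpow_nonneg
    rcases Nat.eq_zero_or_pos (rstW m) with h | h
    · simp [h]
    · exact Real.logb_nonneg one_lt_two (by exact_mod_cast h)
  · exact Real.rpow_nonneg (Nat.cast_nonneg _) _

/-- For `m ≥ 4`: `2^m ≤ w ≤ 2^{2m}`, whence `λ = (log w)^{3/2} / w^{5/4} ≤ (2m)² / 2^{5m/4}`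
(RST: "`λ = Θ̃(2^{-5m/4})`", App. 12). [cite: RossmanServedioTan2015, App. 12 (p. 41)] -/
theorem rstLam_le (m : ℕ) (hm : 4 ≤ m) :
    rstLam m ≤ 4 * (m : ℝ) ^ 2 * (2 : ℝ) ^ (-(5 * (m : ℝ) / 4)) := by
  have hL1 := Real.log_two_gt_d9
  have hL2 := Real.log_two_lt_d9
  have hm' : (4 : ℝ) ≤ m := by exact_mod_cast hm
  have hM : (16 : ℝ) ≤ 2 ^ m := by
    calc (16 : ℝ) = 2 ^ 4 := by norm_num
      _ ≤ 2 ^ m := pow_le_pow_right₀ (by norm_num) hm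
  have hw1 := rstW_gt m
  have hw2 := rstW_le m
  -- lower bound `2^m ≤ w`
  have hwM : (2 : ℝ) ^ m ≤ rstW m := by
    have h : (4 : ℝ) * 2 ^ m * 0.6931471803 ≤ m * 2 ^ m * Real.log 2 :=
      mul_le_mul (mul_le_mul_of_nonneg_right hm' (by positivity)) hL1.le (by norm_num)
        (by positivity)
    linarith
  have hwpos : (0 : ℝ) < rstW m := lt_of_lt_of_le (by positivity) hwM
  -- upper bound `w ≤ 2^(2m)`
  have hmM : (m : ℝ) ≤ 2 ^ m := by exact_mod_cast (Nat.lt_two_pow_self).le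
  have hwMM : (rstW m : ℝ) ≤ (2 : ℝ) ^ (((2 * m : ℕ)) : ℝ) := by
    rw [Real.rpow_natCast, pow_mul, show (2 : ℝ) ^ 2 = 2 * 2 by norm_num, mul_pow]
    calc (rstW m : ℝ) ≤ m * 2 ^ m * Real.log 2 := hw2
      _ ≤ m * 2 ^ m * 1 := mul_le_mul_of_nonneg_left (by linarith) (by positivity)
      _ ≤ 2 ^ m * 2 ^ m := by
          rw [mul_one]
          exact mul_le_mul_of_nonneg_right hmM (by positivity)
  have hlog : Real.logb 2 (rstW m) ≤ 2 * m := by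
    have := (Real.logb_le_iff_le_rpow one_lt_two hwpos).mpr hwMM
    push_cast at this
    exact this
  have hlog0 : 0 ≤ Real.logb 2 (rstW m) :=
    Real.logb_nonneg one_lt_two (le_trans (le_trans (by norm_num) hM) hwM)
  -- numerator
  have hnum : Real.logb 2 (rstW m) ^ ((3 : ℝ) / 2) ≤ 4 * (m : ℝ) ^ 2 := by
    calc Real.logb 2 (rstW m) ^ ((3 : ℝ) / 2) ≤ (2 * (m : ℝ)) ^ ((3 : ℝ) / 2) :=
          Real.rpow_le_rpow hlog0 hlog (by norm_num)
      _ ≤ (2 * (m : ℝ)) ^ ((2 : ℕ) : ℝ) :=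
          Real.rpow_le_rpow_of_exponent_le (by linarith) (by norm_num)
      _ = 4 * (m : ℝ) ^ 2 := by rw [Real.rpow_natCast]; ring
  -- denominator
  have hden : (2 : ℝ) ^ ((5 * (m : ℝ) / 4)) ≤ (rstW m : ℝ) ^ ((5 : ℝ) / 4) := by
    have e : (2 : ℝ) ^ ((5 * (m : ℝ) / 4)) = ((2 : ℝ) ^ m) ^ ((5 : ℝ) / 4) := by
      rw [← Real.rpow_natCast 2 m, ← Real.rpow_mul (by norm_num)]
      congr 1
      ring
    rw [e]
    exact Real.rpow_le_rpow (by positivity) hwM (by norm_num)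
  have hdenpos : (0 : ℝ) < (2 : ℝ) ^ ((5 * (m : ℝ) / 4)) := Real.rpow_pos_of_pos two_pos _
  unfold rstLam
  rw [Real.rpow_neg (by norm_num), ← div_eq_mul_inv]
  exact div_le_div₀ (by positivity) hnum hdenpos hden

/-! ### One step of the induction of RST App. 12 -/

/-- **The one-step estimate of RST App. 12 (p. 41), abstract form.** If `|t q - p| ≤ B` with
`λ + q³ ≤ B` and `B m 2^m ≤ 1/4` (and `m q ≤ 1/4`, `w = m 2^m ln 2 - [0,1)`), then
`|(1 - t)^{q w} - λ - p| ≤ 4 m B`.  This is the inductive step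
"`|t_ℓ q - p| ≤ (2m)^{d-1-ℓ} λ`" of eq. (25) with the second-order terms kept explicit.
[cite: RossmanServedioTan2015, App. 12 (p. 41, proof of Lemma 7.1)] -/
theorem rst_step_abstract {m M L p q w lam B t : ℝ}
    (hL1 : 0.6931471803 < L) (hL2 : L < 0.6931471808)
    (hm : 1 ≤ m) (hM : 0 < M) (hpM : p * M = 1) (hq : 0 < q) (hpq : q ^ 2 = p)
    (hpexp : p = Real.exp (-(m * L)))
    (hw1 : m * M * L - 1 < w) (hw2 : w ≤ m * M * L) (hw0 : 0 ≤ w)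
    (hlam : 0 ≤ lam) (hmq : m * q ≤ 1 / 4)
    (hB1 : lam + q ^ 3 ≤ B) (hB2 : B * m * M ≤ 1 / 4)
    (ht : |t * q - p| ≤ B) :
    |(1 - t) ^ (q * w) - lam - p| ≤ 4 * m * B := by
  have hp : 0 < p := by rw [← hpq]; positivity
  have hL0 : 0 < L := by linarith
  have hq3 : 0 < q ^ 3 := pow_pos hq 3
  have hB0 : 0 ≤ B := le_trans (by positivity) hB1
  have hm0' : (0 : ℝ) ≤ m := by linarith
  have hq1 : q ≤ 1 / 4 := by linarith [mul_le_mul_of_nonneg_right hm hq.le]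
  have hp1 : p ≤ q / 4 := by
    rw [← hpq]
    linarith [mul_nonneg hq.le (by linarith : (0:ℝ) ≤ 1 / 4 - q)]
  -- `B ≤ p / 4`
  have hBM : B * M ≤ 1 / 4 := by
    have : B * M ≤ B * m * M := by
      have := mul_le_mul_of_nonneg_left hm (mul_nonneg hB0 hM.le)
      linarith
    linarith
  have hBp : B ≤ p / 4 := by
    have e : B = B * M * p := by
      rw [mul_assoc, mul_comm M p, hpM, mul_one]
    rw [e]
    linarith [mul_le_mul_of_nonneg_right hBM hp.le]
  -- the range of `u = t q` and of `t`
  have hu1 : p - B ≤ t * q := by linarith [(abs_le.mp ht).1]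
  have hu2 : t * q ≤ p + B := by linarith [(abs_le.mp ht).2]
  have hu0 : 0 < t * q := by linarith
  have hu_hi : t * q ≤ 5 * p / 4 := by linarith
  have ht_eq : t = t * q / q := by rw [mul_div_cancel_right₀ _ hq.ne']
  have ht0 : 0 < t := by rw [ht_eq]; exact div_pos hu0 hq
  have ht_hi : t ≤ 5 * q / 4 := by
    rw [ht_eq, div_le_iff₀ hq]
    linarith
  have ht1 : t < 1 := by linarith
  have hqw : 0 ≤ q * w := by positivity
  -- useful products with `p M = 1`
  have e1 : m * M * L * p = m * L := by
    calc m * M * L * p = m * L * (p * M) := by ring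
      _ = m * L := by rw [hpM, mul_one]
  have e2 : p * (m * M * L * B) = m * L * B := by
    calc p * (m * M * L * B) = (p * M) * (m * L * B) := by ring
      _ = m * L * B := by rw [hpM, one_mul]
  have hmMLB : m * M * L * B ≤ L / 4 := by
    have : m * M * L * B = L * (B * m * M) := by ring
    rw [this]
    linarith [mul_le_mul_of_nonneg_left hB2 hL0.le]
  ------------------------------------------------------------------
  -- Upper bound: `(1-t)^{qw} ≤ e^{-wu} ≤ p e^{x}`, `x = m M L B + 5p/4 ∈ [0,1]`.
  ------------------------------------------------------------------
  have hup : (1 - t) ^ (q * w) ≤ p + (2 * m * L + 1) * B := by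
    have h1 := one_sub_rpow_le_exp_neg ht1 hqw
    have eqw : q * w * t = w * (t * q) := by ring
    rw [eqw] at h1
    have h2 : -(w * (t * q)) ≤ -(m * L) + (m * M * L * B + 5 * p / 4) := by
      have i1 : (m * M * L - 1) * (t * q) ≤ w * (t * q) :=
        mul_le_mul_of_nonneg_right hw1.le hu0.le
      have i2 : m * M * L * (p - B) ≤ m * M * L * (t * q) :=
        mul_le_mul_of_nonneg_left hu1 (by positivity)
      linarith
    have hx0 : 0 ≤ m * M * L * B + 5 * p / 4 := by positivity
    have hx1 : m * M * L * B + 5 * p / 4 ≤ 1 := by linarith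
    -- RST Fact 5.3: `eˣ ≤ 1 + 2x` on `[0, 1]` (the tree's `exp_le_one_add_two_mul`, inlined)
    have hexp : Real.exp (m * M * L * B + 5 * p / 4) ≤ 1 + 2 * (m * M * L * B + 5 * p / 4) := by
      have h := Real.abs_exp_sub_one_sub_id_le (abs_le.mpr ⟨by linarith, hx1⟩)
      have hxx := mul_le_mul_of_nonneg_right hx1 hx0
      linarith [(abs_le.mp h).2]
    have h3 : Real.exp (-(w * (t * q))) ≤ p * (1 + 2 * (m * M * L * B + 5 * p / 4)) := by
      calc Real.exp (-(w * (t * q)))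
          ≤ Real.exp (-(m * L) + (m * M * L * B + 5 * p / 4)) := Real.exp_le_exp.mpr h2
        _ = p * Real.exp (m * M * L * B + 5 * p / 4) := by rw [Real.exp_add, hpexp]
        _ ≤ p * (1 + 2 * (m * M * L * B + 5 * p / 4)) := mul_le_mul_of_nonneg_left hexp hp.le
    have hp2 : p ^ 2 ≤ q ^ 3 / 4 := by
      rw [← hpq]
      linarith [mul_nonneg hq3.le (by linarith : (0:ℝ) ≤ 1 / 4 - q)]
    have hq3B : q ^ 3 ≤ B := by linarith
    linarith
  ------------------------------------------------------------------
  -- Lower bound: `(1-t)^{qw} ≥ e^{-wu/(1-t)} ≥ e^{-wu(1+2t)} ≥ p (1 - y)`,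
  -- `y = m M L B + (25/8) m L q`.
  ------------------------------------------------------------------
  have hlo : p - (m * L * B + 4 * m * L * q ^ 3) ≤ (1 - t) ^ (q * w) := by
    have h1 := exp_neg_le_one_sub_rpow ht1 hqw
    have h1t : 0 < 1 - t := by linarith
    have hwu0 : 0 ≤ w * (t * q) := by positivity
    have h2 : q * w * t / (1 - t) ≤ w * (t * q) * (1 + 2 * t) := by
      rw [div_le_iff₀ h1t]
      have eqw : q * w * t = w * (t * q) := by ring
      rw [eqw]
      have : 1 ≤ (1 + 2 * t) * (1 - t) := by
        linarith [mul_nonneg ht0.le (by linarith : (0:ℝ) ≤ 1 - 2 * t)]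
      linarith [mul_le_mul_of_nonneg_left this hwu0]
    have hut : (t * q) * t ≤ 25 / 16 * (p * q) := by
      have : (t * q) * t * q ≤ 25 / 16 * (p * q) * q := by
        have hh : (t * q) * (t * q) ≤ (5 * p / 4) * (5 * p / 4) :=
          mul_le_mul hu_hi hu_hi hu0.le (by linarith)
        rw [← hpq] at hh ⊢
        linarith
      exact le_of_mul_le_mul_right this hq
    have h3 : w * (t * q) * (1 + 2 * t) ≤
        m * L + (m * M * L * B + 25 / 8 * (m * L * q)) := by
      have hw2' : w * (t * q) ≤ m * M * L * (t * q) := mul_le_mul_of_nonneg_right hw2 hu0.le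
      have hA : m * M * L * (t * q) ≤ m * M * L * (p + B) :=
        mul_le_mul_of_nonneg_left hu2 (by positivity)
      have hB' : w * (t * q) * t ≤ m * M * L * (t * q) * t :=
        mul_le_mul_of_nonneg_right hw2' ht0.le
      have hC : m * M * L * ((t * q) * t) ≤ m * M * L * (25 / 16 * (p * q)) :=
        mul_le_mul_of_nonneg_left hut (by positivity)
      have e' : m * M * L * (25 / 16 * (p * q)) = 25 / 16 * (m * L * q) := by
        calc m * M * L * (25 / 16 * (p * q)) = 25 / 16 * (m * L * q) * (p * M) := by ring
          _ = 25 / 16 * (m * L * q) := by rw [hpM, mul_one]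
      linarith
    have e3 : p * (25 / 8 * (m * L * q)) = 25 / 8 * (m * L * q ^ 3) := by
      rw [← hpq]
      ring
    have hmLq3 : 0 ≤ m * L * q ^ 3 := by positivity
    calc p - (m * L * B + 4 * m * L * q ^ 3)
        ≤ p * (1 - (m * M * L * B + 25 / 8 * (m * L * q))) := by linarith
      _ ≤ p * Real.exp (-(m * M * L * B + 25 / 8 * (m * L * q))) := by
          apply mul_le_mul_of_nonneg_left _ hp.le
          linarith [Real.add_one_le_exp (-(m * M * L * B + 25 / 8 * (m * L * q)))]
      _ = Real.exp (-(m * L + (m * M * L * B + 25 / 8 * (m * L * q)))) := by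
          rw [hpexp, ← Real.exp_add]
          congr 1
          ring
      _ ≤ Real.exp (-(q * w * t / (1 - t))) := Real.exp_le_exp.mpr (by linarith)
      _ ≤ (1 - t) ^ (q * w) := h1
  ------------------------------------------------------------------
  -- Assembly.
  ------------------------------------------------------------------
  rw [abs_le]
  constructor
  · have key : m * L * B + 4 * m * L * q ^ 3 + lam ≤ 4 * m * B := by
      have j1 : 3.3 * m ≤ (4 - L) * m := mul_le_mul_of_nonneg_right (by linarith) hm0'
      have h4L : (0 : ℝ) ≤ (4 - L) * m := by linarith
      have i1 : (4 - L) * m * (lam + q ^ 3) ≤ (4 - L) * m * B :=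
        mul_le_mul_of_nonneg_left hB1 h4L
      have i2 : lam ≤ (4 - L) * m * lam := by
        have := mul_le_mul_of_nonneg_right (show (1:ℝ) ≤ (4 - L) * m by linarith) hlam
        linarith
      have i3 : 4 * m * L * q ^ 3 ≤ (4 - L) * m * q ^ 3 := by
        have j2 : 4 * L ≤ 4 - L := by linarith
        have := mul_le_mul_of_nonneg_right j2 (by positivity : (0:ℝ) ≤ m * q ^ 3)
        linarith
      linarith
    linarith
  · have j1 : 2.6 * m ≤ (4 - 2 * L) * m := mul_le_mul_of_nonneg_right (by linarith) hm0'
    have j2 : (0 : ℝ) ≤ (4 * m - 2 * m * L - 1) * B := mul_nonneg (by linarith) hB0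
    linarith

/-- The one-step estimate for the actual parameters of RST §6–§7.1.
[cite: RossmanServedioTan2015, App. 12 (p. 41)] -/
theorem rst_step (m : ℕ) (hm : 1 ≤ m) (hmq : (m : ℝ) * rstQ m ≤ 1 / 4) {B t : ℝ}
    (hB1 : rstLam m + rstQ m ^ 3 ≤ B) (hB2 : B * m * 2 ^ m ≤ 1 / 4)
    (ht : |t * rstQ m - rstP m| ≤ B) :
    |(1 - t) ^ (rstQ m * rstW m) - rstLam m - rstP m| ≤ 4 * m * B :=
  rst_step_abstract Real.log_two_gt_d9 Real.log_two_lt_d9 (by exact_mod_cast hm) (by positivity)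
    (rstP_mul_two_pow m) (rstQ_pos m) (rstQ_sq m) (rstP_eq_exp m) (rstW_gt m) (rstW_le m)
    (Nat.cast_nonneg _) (rstLam_nonneg m) hmq hB1 hB2 ht

/-- **RST App. 12, eq. (25), in the form `|t_{d-1-j} q - p| ≤ (4m)^j (λ + q³)`** for all
`j ≤ J`, as long as `(4m)^J (λ + q³) m 2^m ≤ 1/4` (the quantitative content of the regime
`d ≤ c m / log m`). [cite: RossmanServedioTan2015, App. 12 (p. 41, eq. (25))] -/
theorem rstTAux_mul_rstQ_sub_rstP (m J : ℕ) (hm : 1 ≤ m) (hmq : (m : ℝ) * rstQ m ≤ 1 / 4)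
    (hJ : (4 * (m : ℝ)) ^ J * (rstLam m + rstQ m ^ 3) * m * 2 ^ m ≤ 1 / 4) :
    ∀ j ≤ J, |rstTAux m j * rstQ m - rstP m| ≤ (4 * (m : ℝ)) ^ j * (rstLam m + rstQ m ^ 3) := by
  have hq := rstQ_pos m
  have hm' : (1 : ℝ) ≤ m := by exact_mod_cast hm
  intro j
  induction j with
  | zero =>
    intro _
    simp only [rstTAux, pow_zero, one_mul]
    rw [div_mul_cancel₀ _ hq.ne', show rstP m - rstLam m - rstP m = -rstLam m by ring, abs_neg,
      abs_of_nonneg (rstLam_nonneg m)]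
    linarith [pow_pos hq 3]
  | succ j ih =>
    intro hj
    have ih' := ih (Nat.le_of_succ_le hj)
    simp only [rstTAux]
    rw [div_mul_cancel₀ _ hq.ne']
    have hpow : (4 * (m : ℝ)) ^ j ≤ (4 * (m : ℝ)) ^ J :=
      pow_le_pow_right₀ (by linarith) (by omega)
    have hpos : 0 ≤ (rstLam m + rstQ m ^ 3) * m * 2 ^ m := by
      have := rstLam_nonneg m
      positivity
    have hB2 : (4 * (m : ℝ)) ^ j * (rstLam m + rstQ m ^ 3) * m * 2 ^ m ≤ 1 / 4 := by
      linarith [mul_le_mul_of_nonneg_right hpow hpos]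
    calc |(1 - rstTAux m j) ^ (rstQ m * rstW m) - rstLam m - rstP m|
        ≤ 4 * m * ((4 * (m : ℝ)) ^ j * (rstLam m + rstQ m ^ 3)) :=
          rst_step m hm hmq (le_mul_of_one_le_left (add_nonneg (rstLam_nonneg m) (pow_nonneg hq.le 3))
            (one_le_pow₀ (by linarith))) hB2 ih'
      _ = (4 * (m : ℝ)) ^ (j + 1) * (rstLam m + rstQ m ^ 3) := by ring

/-! ### `w₀` is a ceiling -/

/-- For `0 < t₁ < 1` the defining set of `w₀` is `{n : ℕ | n ≥ ln 2 / (q · (-ln(1 - t₁)))}`, so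
`w₀ = ⌈ln 2 / (q · (-ln (1 - t₁)))⌉₊`. [cite: RossmanServedioTan2015, §6 (p. 15, eq. for `w₀`)] -/
theorem rstW0_eq_ceil (m d : ℕ) (ht0 : 0 < rstT m d 1) (ht1 : rstT m d 1 < 1) :
    rstW0 m d = ⌈Real.log 2 / (rstQ m * -Real.log (1 - rstT m d 1))⌉₊ := by
  unfold rstW0
  have hq := rstQ_pos m
  have h1t : 0 < 1 - rstT m d 1 := by linarith
  have hlog : Real.log (1 - rstT m d 1) < 0 := Real.log_neg h1t (by linarith)
  have hden : 0 < rstQ m * -Real.log (1 - rstT m d 1) := mul_pos hq (by linarith)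
  have key : ∀ n : ℕ, (1 - rstT m d 1) ^ (rstQ m * n) ≤ (1 : ℝ) / 2 ↔
      Real.log 2 / (rstQ m * -Real.log (1 - rstT m d 1)) ≤ n := by
    intro n
    rw [Real.rpow_def_of_pos h1t, ← Real.le_log_iff_exp_le (by norm_num : (0:ℝ) < 1 / 2),
      div_le_iff₀ hden, one_div, Real.log_inv]
    constructor <;> intro h <;> linarith
  have hset : {w₀ : ℕ | (1 - rstT m d 1) ^ (rstQ m * w₀) ≤ (1 : ℝ) / 2} =
      Set.Ici ⌈Real.log 2 / (rstQ m * -Real.log (1 - rstT m d 1))⌉₊ := by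
    ext n
    simp only [Set.mem_setOf_eq, Set.mem_Ici, key, Nat.ceil_le]
  rw [hset, csInf_Ici]

/-! ### From `|t₁ q - p| ≤ η p` to `|w₀ / (2^m ln 2) - 1| ≤ ε` -/

/-- **The `w₀` estimate, abstract form.** If `|t q - p| ≤ η p` with `η ≤ min(ε,1)/4`, `p, q ≤ η`,
`q² = p = 1/M`, and `X ≤ w₀ < X + 1` for `X = ln 2 / (q · (-ln(1-t)))`, then
`|w₀/(M ln 2) - 1| ≤ ε` (RST §6: "the estimates for `t₁` and `q` … imply
`w₀ = 2^m ln 2 (1 ± o(1))`"). [cite: RossmanServedioTan2015, §6 (p. 15)] -/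
theorem rst_w0_abstract {M L p q t w0 η ε : ℝ}
    (hL1 : 0.6931471803 < L) (hL2 : L < 0.6931471808) (hM : 0 < M) (hpM : p * M = 1)
    (hq : 0 < q) (hpq : q ^ 2 = p)
    (hε : 0 < ε) (hηε : η ≤ ε / 4) (hη1 : η ≤ 1 / 4) (hpη : p ≤ η) (hqη : q ≤ η)
    (ht : |t * q - p| ≤ η * p)
    (hw0a : L / (q * -Real.log (1 - t)) ≤ w0) (hw0b : w0 < L / (q * -Real.log (1 - t)) + 1) :
    |w0 / (M * L) - 1| ≤ ε := by
  have hp : 0 < p := by rw [← hpq]; positivity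
  have hL0 : 0 < L := by linarith
  have hη0 : 0 ≤ η := le_trans hp.le hpη
  -- range of `u = t q` and `t`
  have hu1 : p * (1 - η) ≤ t * q := by linarith [(abs_le.mp ht).1]
  have hu2 : t * q ≤ p * (1 + η) := by linarith [(abs_le.mp ht).2]
  have hu0 : 0 < t * q := lt_of_lt_of_le (mul_pos hp (by linarith)) hu1
  have ht_eq : t = t * q / q := by rw [mul_div_cancel_right₀ _ hq.ne']
  have ht0 : 0 < t := by rw [ht_eq]; exact div_pos hu0 hq
  have ht_hi : t ≤ 5 * q / 4 := by
    rw [ht_eq, div_le_iff₀ hq]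
    linarith [mul_le_mul_of_nonneg_left hη1 hp.le]
  have ht1 : t < 1 := by linarith
  have h1t : 0 < 1 - t := by linarith
  -- `ℓ = -ln(1-t)` satisfies `t ≤ ℓ ≤ t/(1-t)`
  set ℓ := -Real.log (1 - t) with hℓ
  have hℓ1 : t ≤ ℓ := by
    have := Real.log_le_sub_one_of_pos h1t
    rw [hℓ]; linarith
  have hℓ2 : ℓ * (1 - t) ≤ t := by
    have h := Real.one_sub_inv_le_log_of_pos h1t
    have e : (1 : ℝ) - (1 - t)⁻¹ = -(t / (1 - t)) := by
      field_simp
      ring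
    rw [e] at h
    have : ℓ ≤ t / (1 - t) := by rw [hℓ]; linarith
    rwa [le_div_iff₀ h1t] at this
  have hℓ0 : 0 < ℓ := lt_of_lt_of_le ht0 hℓ1
  have hqℓ : 0 < q * ℓ := mul_pos hq hℓ0
  -- `X (q ℓ) = L`
  set X := L / (q * ℓ) with hX
  have hXqℓ : X * (q * ℓ) = L := div_mul_cancel₀ _ hqℓ.ne'
  have hX0 : 0 ≤ X := by positivity
  have hw00 : 0 ≤ w0 := le_trans hX0 hw0a
  -- `X u ≤ L` and `L (1 - t) ≤ X u`
  have hXu1 : X * (t * q) ≤ L := by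
    calc X * (t * q) ≤ X * (q * ℓ) := by
          apply mul_le_mul_of_nonneg_left _ hX0
          nlinarith
      _ = L := hXqℓ
  have hXu2 : L * (1 - t) ≤ X * (t * q) := by
    calc L * (1 - t) = X * (q * (ℓ * (1 - t))) := by rw [← hXqℓ]; ring
      _ ≤ X * (q * t) := by
          apply mul_le_mul_of_nonneg_left _ hX0
          exact mul_le_mul_of_nonneg_left hℓ2 hq.le
      _ = X * (t * q) := by ring
  have hML : 0 < M * L := mul_pos hM hL0
  rw [abs_le]
  constructor
  · -- lower bound: `(1 - ε) M L ≤ w0`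
    have goal : (1 - ε) * (M * L) ≤ w0 := by
      rcases le_or_gt 1 ε with hε1 | hε1
      · have : 0 ≤ (ε - 1) * (M * L) := mul_nonneg (by linarith) hML.le
        linarith
      · -- `w0 u ≥ X u ≥ L (1 - t) ≥ (1-ε)(1+η) L ≥ (1 - ε) M L u`
        have i1 : X * (t * q) ≤ w0 * (t * q) := mul_le_mul_of_nonneg_right hw0a hu0.le
        have i2 : (1 - ε) * (M * L) * (t * q) ≤ (1 - ε) * (M * L) * (p * (1 + η)) :=
          mul_le_mul_of_nonneg_left hu2 (mul_nonneg (by linarith) hML.le)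
        have e : (1 - ε) * (M * L) * (p * (1 + η)) = (1 - ε) * (1 + η) * L * (p * M) := by ring
        rw [hpM, mul_one] at e
        have i3' : (1 - ε) * (1 + η) ≤ 1 - t := by linarith [mul_nonneg hε.le hη0]
        have i3 : (1 - ε) * (1 + η) * L ≤ L * (1 - t) := by
          linarith [mul_le_mul_of_nonneg_left i3' hL0.le]
        have : (1 - ε) * (M * L) * (t * q) ≤ w0 * (t * q) := by linarith
        exact le_of_mul_le_mul_right this hu0
    rw [le_sub_iff_add_le, le_div_iff₀ hML]
    linarith
  · -- upper bound: `w0 ≤ (1 + ε) M L`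
    have goal : w0 ≤ (1 + ε) * (M * L) := by
      have i1 : w0 * (t * q) ≤ (X + 1) * (t * q) := mul_le_mul_of_nonneg_right hw0b.le hu0.le
      have i2 : (1 + ε) * (M * L) * (p * (1 - η)) ≤ (1 + ε) * (M * L) * (t * q) :=
        mul_le_mul_of_nonneg_left hu1 (by positivity)
      have e : (1 + ε) * (M * L) * (p * (1 - η)) = (1 + ε) * (1 - η) * L * (p * M) := by ring
      rw [hpM, mul_one] at e
      have j1 : p * (1 + η) ≤ 5 / 16 * ε := by linarith [mul_le_mul_of_nonneg_left hη1 hp.le]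
      have j2 : ε / 2 ≤ ε - η - ε * η := by linarith [mul_le_mul_of_nonneg_left hη1 hε.le]
      have i3 : L + p * (1 + η) ≤ (1 + ε) * (1 - η) * L := by
        linarith [mul_le_mul_of_nonneg_left j2 hL0.le, mul_le_mul_of_nonneg_left hL1.le hε.le]
      have : w0 * (t * q) ≤ (1 + ε) * (M * L) * (t * q) := by linarith
      exact le_of_mul_le_mul_right this hu0
    rw [sub_le_iff_le_add, div_le_iff₀ hML]
    linarith

/-! ### "For `m` sufficiently large" -/

/-- `5 m³ 2^{-m/8} → 0`, in threshold form. [folklore] -/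
theorem rst_eventually_small (η : ℝ) (hη : 0 < η) :
    ∃ m₀ : ℕ, ∀ m : ℕ, m₀ ≤ m → 5 * (m : ℝ) ^ 3 * (2 : ℝ) ^ (-(m : ℝ) / 8) ≤ η := by
  have hρ : 1 < (2 : ℝ) ^ ((1 : ℝ) / 8) := Real.one_lt_rpow one_lt_two (by norm_num)
  have hlim := (tendsto_pow_const_div_const_pow_of_one_lt 3 hρ).const_mul 5
  rw [mul_zero] at hlim
  obtain ⟨m₀, hm₀⟩ := Filter.eventually_atTop.mp (hlim.eventually_lt_const hη)
  refine ⟨m₀, fun m hm => ?_⟩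
  have h := hm₀ m hm
  have e : (2 : ℝ) ^ (-(m : ℝ) / 8) = (((2 : ℝ) ^ ((1 : ℝ) / 8)) ^ m)⁻¹ := by
    rw [← Real.rpow_natCast, ← Real.rpow_mul (by norm_num), ← Real.rpow_neg (by norm_num)]
    congr 1
    ring
  rw [e]
  calc 5 * (m : ℝ) ^ 3 * (((2 : ℝ) ^ ((1 : ℝ) / 8)) ^ m)⁻¹
      = 5 * ((m : ℝ) ^ 3 / ((2 : ℝ) ^ ((1 : ℝ) / 8)) ^ m) := by ring
    _ ≤ η := h.le

/-! ### The theorem -/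

/-- **Rossman–Servedio–Tan 2015, §6 (p. 15): `w₀ = 2^m ln 2 · (1 ± o_m(1))` uniformly in the regime
`2 ≤ d ≤ c m / log m` of Lemma 7.1** — discharge of the named fact
`rossmanServedioTan2015_w0_asymp`, with the universal constant `c = 1/16`.
[cite: RossmanServedioTan2015, §6 (p. 15), Lemma 7.1 (p. 16) and App. 12 (p. 41)] -/
theorem rossmanServedioTan2015_w0_asymp_holds : rossmanServedioTan2015_w0_asymp := by
  refine ⟨1 / 16, by norm_num, ?_⟩
  intro ε hε
  obtain ⟨m₁, hm₁⟩ := rst_eventually_small (min ε 1 / 4) (div_pos (lt_min hε one_pos) (by norm_num))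
  refine ⟨max m₁ 4, ?_⟩
  intro m hm d hd hdc
  have hm4 : 4 ≤ m := le_trans (le_max_right _ _) hm
  have hm1 : 1 ≤ m := le_trans (by norm_num) hm4
  have hm4' : (4 : ℝ) ≤ m := by exact_mod_cast hm4
  have hsmall := hm₁ m (le_trans (le_max_left _ _) hm)
  have hL1 := Real.log_two_gt_d9
  have hL2 := Real.log_two_lt_d9
  -- `η := min ε 1 / 4`
  have hηε : min ε 1 / 4 ≤ ε / 4 := by
    have := min_le_left ε 1
    linarith
  have hη1 : min ε 1 / 4 ≤ 1 / 4 := by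
    have := min_le_right ε 1
    linarith
  have hη0 : 0 < min ε 1 / 4 := div_pos (lt_min hε one_pos) (by norm_num)
  -- everything is a power of `r := 2^{-m/8}`
  set r : ℝ := (2 : ℝ) ^ (-(m : ℝ) / 8) with hr
  have hr0 : 0 < r := Real.rpow_pos_of_pos two_pos _
  have hr1 : r ≤ 1 := Real.rpow_le_one_of_one_le_of_nonpos one_le_two (by
    have : (0:ℝ) ≤ m := Nat.cast_nonneg m
    linarith)
  have hrpow : ∀ k : ℕ, r ^ k = (2 : ℝ) ^ (-(m : ℝ) / 8 * k) := fun k => by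
    rw [hr, ← Real.rpow_natCast, ← Real.rpow_mul (by norm_num)]
  have hq : rstQ m = r ^ 4 := by
    rw [hrpow]; unfold rstQ; congr 1; push_cast; ring
  have hp : rstP m = r ^ 8 := by
    rw [hrpow]; unfold rstP; congr 1; push_cast; ring
  have hMr : (2 : ℝ) ^ m * r ^ 8 = 1 := by rw [← hp, mul_comm, rstP_mul_two_pow]
  have h54 : (2 : ℝ) ^ m * (2 : ℝ) ^ (-(5 * (m : ℝ) / 4)) = r ^ 2 := by
    rw [hrpow, ← Real.rpow_natCast 2 m, ← Real.rpow_add two_pos]; congr 1; push_cast; ring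
  have hinv : (2 : ℝ) ^ ((m : ℝ) / 8) * r = 1 := by
    rw [hr, ← Real.rpow_add two_pos, show (m : ℝ) / 8 + -(m : ℝ) / 8 = 0 by ring, Real.rpow_zero]
  have hm0 : (0 : ℝ) < m := by linarith
  have hm3 : (m : ℝ) ≤ (m : ℝ) ^ 3 := le_self_pow₀ (by linarith) (by norm_num)
  -- (a) `m q ≤ 1/4` (indeed `≤ η / 5`)
  have hr4 : r ^ 4 ≤ r := by
    calc r ^ 4 ≤ r ^ 1 := pow_le_pow_of_le_one hr0.le hr1 (by norm_num)
      _ = r := pow_one r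
  have hmq' : (m : ℝ) * rstQ m ≤ min ε 1 / 4 / 5 := by
    rw [hq]
    calc (m : ℝ) * r ^ 4 ≤ (m : ℝ) ^ 3 * r := mul_le_mul hm3 hr4 (by positivity) (by positivity)
      _ ≤ min ε 1 / 4 / 5 := by linarith
  have hmq : (m : ℝ) * rstQ m ≤ 1 / 4 := by linarith
  -- (b) the regime: `(4m)^(d-2) ≤ 2^{m/8}`
  have hlogm : 2 ≤ Real.logb 2 m := by
    rw [Real.le_logb_iff_rpow_le one_lt_two hm0, Real.rpow_two]
    linarith
  have hlogm0 : 0 < Real.logb 2 m := by linarith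
  have hdlog : (d : ℝ) * Real.logb 2 m ≤ m / 16 := by
    have := (le_div_iff₀ hlogm0).mp hdc
    linarith
  have hreg : (4 * (m : ℝ)) ^ (d - 2) ≤ (2 : ℝ) ^ ((m : ℝ) / 8) := by
    have h4m : (2 : ℝ) ^ (Real.logb 2 (4 * m)) = 4 * (m : ℝ) :=
      Real.rpow_logb two_pos (by norm_num) (by positivity)
    have hlog4 : Real.logb 2 4 = 2 := by
      rw [show (4 : ℝ) = 2 ^ ((2 : ℕ) : ℝ) by rw [Real.rpow_natCast]; norm_num,
        Real.logb_rpow two_pos (by norm_num)]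
      norm_num
    have hlog4m : Real.logb 2 (4 * m) ≤ 2 * Real.logb 2 m := by
      rw [Real.logb_mul (by norm_num) hm0.ne', hlog4]
      linarith
    have hJd : ((d - 2 : ℕ) : ℝ) ≤ d := by exact_mod_cast Nat.sub_le d 2
    calc (4 * (m : ℝ)) ^ (d - 2) = ((2 : ℝ) ^ (Real.logb 2 (4 * m))) ^ (d - 2) := by rw [h4m]
      _ = (2 : ℝ) ^ (Real.logb 2 (4 * m) * ((d - 2 : ℕ) : ℝ)) := by
          rw [← Real.rpow_natCast, ← Real.rpow_mul two_pos.le]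
      _ ≤ (2 : ℝ) ^ ((m : ℝ) / 8) := by
          apply Real.rpow_le_rpow_of_exponent_le one_le_two
          have : Real.logb 2 (4 * m) * ((d - 2 : ℕ) : ℝ) ≤ 2 * Real.logb 2 m * d :=
            mul_le_mul hlog4m hJd (Nat.cast_nonneg _) (by linarith)
          linarith
  -- (c) `(λ + q³) m 2^m ≤ 4 m³ r² + m r⁴`
  have hlam := rstLam_le m hm4
  have hlam0 := rstLam_nonneg m
  have hS : (rstLam m + rstQ m ^ 3) * m * 2 ^ m ≤ 4 * (m : ℝ) ^ 3 * r ^ 2 + m * r ^ 4 := by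
    have e1 : (4 * (m : ℝ) ^ 2 * (2 : ℝ) ^ (-(5 * (m : ℝ) / 4))) * m * 2 ^ m
        = 4 * (m : ℝ) ^ 3 * r ^ 2 := by rw [← h54]; ring
    have e2 : rstQ m ^ 3 * m * 2 ^ m = m * r ^ 4 := by
      rw [hq]
      calc (r ^ 4) ^ 3 * (m : ℝ) * 2 ^ m = m * r ^ 4 * (2 ^ m * r ^ 8) := by ring
        _ = m * r ^ 4 := by rw [hMr, mul_one]
    have i1 : rstLam m * m * 2 ^ m ≤ (4 * (m : ℝ) ^ 2 * (2 : ℝ) ^ (-(5 * (m : ℝ) / 4))) * m * 2 ^ m :=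
      mul_le_mul_of_nonneg_right (mul_le_mul_of_nonneg_right hlam hm0.le) (by positivity)
    linarith
  -- (d) the hypothesis of the induction, with `η` in place of `1/4`
  have hJη : (4 * (m : ℝ)) ^ (d - 2) * (rstLam m + rstQ m ^ 3) * m * 2 ^ m ≤ min ε 1 / 4 := by
    have hpos : 0 ≤ (rstLam m + rstQ m ^ 3) * m * 2 ^ m := by
      have := rstQ_pos m
      positivity
    calc (4 * (m : ℝ)) ^ (d - 2) * (rstLam m + rstQ m ^ 3) * m * 2 ^ m
        = (4 * (m : ℝ)) ^ (d - 2) * ((rstLam m + rstQ m ^ 3) * m * 2 ^ m) := by ring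
      _ ≤ (2 : ℝ) ^ ((m : ℝ) / 8) * (4 * (m : ℝ) ^ 3 * r ^ 2 + m * r ^ 4) :=
          mul_le_mul hreg hS hpos (by positivity)
      _ = (4 * (m : ℝ) ^ 3 * r + m * r ^ 3) * ((2 : ℝ) ^ ((m : ℝ) / 8) * r) := by ring
      _ = 4 * (m : ℝ) ^ 3 * r + m * r ^ 3 := by rw [hinv, mul_one]
      _ ≤ 5 * (m : ℝ) ^ 3 * r := by
          have : r ^ 3 ≤ r := by
            calc r ^ 3 ≤ r ^ 1 := pow_le_pow_of_le_one hr0.le hr1 (by norm_num)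
              _ = r := pow_one r
          linarith [mul_le_mul hm3 this (by positivity) (by positivity)]
      _ ≤ min ε 1 / 4 := hsmall
  have hJ : (4 * (m : ℝ)) ^ (d - 2) * (rstLam m + rstQ m ^ 3) * m * 2 ^ m ≤ 1 / 4 :=
    hJη.trans hη1
  -- (e) the induction, at `j = d - 2`: `|t₁ q - p| ≤ η p`
  have hind := rstTAux_mul_rstQ_sub_rstP m (d - 2) hm1 hmq hJ (d - 2) le_rfl
  have ht1def : rstT m d 1 = rstTAux m (d - 2) := by
    unfold rstT
    rw [Nat.sub_sub]
  have hqpos := rstQ_pos m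
  have hppos := rstP_pos m
  have hm1' : (1 : ℝ) ≤ m := by exact_mod_cast hm1
  have ht : |rstT m d 1 * rstQ m - rstP m| ≤ min ε 1 / 4 * rstP m := by
    rw [ht1def]
    refine hind.trans ?_
    -- `B_J = B_J 2^m p ≤ B_J m 2^m p ≤ η p`
    have hB0 : 0 ≤ (4 * (m : ℝ)) ^ (d - 2) * (rstLam m + rstQ m ^ 3) := by positivity
    set B := (4 * (m : ℝ)) ^ (d - 2) * (rstLam m + rstQ m ^ 3) with hB
    have e : B = B * 2 ^ m * rstP m := by
      rw [mul_assoc, mul_comm ((2 : ℝ) ^ m) (rstP m), rstP_mul_two_pow, mul_one]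
    have i1 : B * 2 ^ m ≤ B * m * 2 ^ m := by
      have := mul_le_mul_of_nonneg_left hm1' (by positivity : (0 : ℝ) ≤ B * 2 ^ m)
      linarith
    rw [e]
    calc B * 2 ^ m * rstP m ≤ B * m * 2 ^ m * rstP m := mul_le_mul_of_nonneg_right i1 hppos.le
      _ ≤ min ε 1 / 4 * rstP m := mul_le_mul_of_nonneg_right hJη hppos.le
  -- (f) `0 < t₁ < 1`, so `w₀` is the ceiling
  have hpη : rstP m ≤ min ε 1 / 4 := by
    rw [hp]
    have h8 : r ^ 8 ≤ r := by
      calc r ^ 8 ≤ r ^ 1 := pow_le_pow_of_le_one hr0.le hr1 (by norm_num)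
        _ = r := pow_one r
    have := mul_le_mul (one_le_pow₀ hm1' : (1 : ℝ) ≤ (m : ℝ) ^ 3) h8 (by positivity) (by positivity)
    linarith
  have hqη : rstQ m ≤ min ε 1 / 4 := by
    have := mul_le_mul_of_nonneg_right hm1' hqpos.le
    linarith
  have hu1 : rstP m * (1 - min ε 1 / 4) ≤ rstT m d 1 * rstQ m := by linarith [(abs_le.mp ht).1]
  have hu2 : rstT m d 1 * rstQ m ≤ rstP m * (1 + min ε 1 / 4) := by linarith [(abs_le.mp ht).2]
  have hu0 : 0 < rstT m d 1 * rstQ m := lt_of_lt_of_le (mul_pos hppos (by linarith)) hu1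
  have ht_eq : rstT m d 1 = rstT m d 1 * rstQ m / rstQ m := by
    rw [mul_div_cancel_right₀ _ hqpos.ne']
  have ht0 : 0 < rstT m d 1 := by
    rw [ht_eq]
    exact div_pos hu0 hqpos
  have ht1 : rstT m d 1 < 1 := by
    have : rstT m d 1 ≤ 5 * rstQ m / 4 := by
      rw [ht_eq, div_le_iff₀ hqpos]
      linarith [rstQ_sq m, mul_le_mul_of_nonneg_left hη1 hppos.le]
    linarith
  have hceil := rstW0_eq_ceil m d ht0 ht1
  have hX0 : 0 ≤ Real.log 2 / (rstQ m * -Real.log (1 - rstT m d 1)) := by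
    have hneg : Real.log (1 - rstT m d 1) < 0 := Real.log_neg (by linarith) (by linarith)
    exact div_nonneg (Real.log_pos one_lt_two).le (mul_nonneg hqpos.le (by linarith))
  have hw0a : Real.log 2 / (rstQ m * -Real.log (1 - rstT m d 1)) ≤ (rstW0 m d : ℝ) := by
    rw [hceil]; exact Nat.le_ceil _
  have hw0b : (rstW0 m d : ℝ) < Real.log 2 / (rstQ m * -Real.log (1 - rstT m d 1)) + 1 := by
    rw [hceil]; exact Nat.ceil_lt_add_one hX0
  -- (g) conclude
  exact rst_w0_abstract (w0 := (rstW0 m d : ℝ)) hL1 hL2 (by positivity : (0:ℝ) < 2 ^ m)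
    (rstP_mul_two_pow m) hqpos (rstQ_sq m) hε hηε hη1 hpη hqη ht hw0a hw0b

/-! ### Lemma 7.1: `t_k = q ± q^{1.1}` in the regime `d ≤ c m / log m` -/

/-- **Rossman–Servedio–Tan 2015, Lemma 7.1** ("the values `t_k` stay under control") — discharge of
the named fact `rossmanServedioTan2015_lem71` with the universal constant `c = 1/64`: for
`2 ≤ d ≤ m / (64 log₂ m)` and `1 ≤ k ≤ d - 1`, `|t_k - q| ≤ q^{1.1}`.  From eq. (25) in the form
`rstTAux_mul_rstQ_sub_rstP` (`|t_k q - p| ≤ (4m)^{d-2} (λ + q³)`): the regime forces `m ≥ 128`,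
`m ≤ 2^{m/128}` and `(4m)^{d-2} ≤ 2^{3m/64}`, while `λ + q³ ≤ 2^{-19m/16}` (`rstLam_le`), whence
`|t_k - q| = |t_k q - p| / q ≤ 2^{3m/64} · 2^{-19m/16} · 2^{m/2} = 2^{-41m/64} ≤ 2^{-0.55 m} = q^{1.1}`
(RST, App. 12, p. 41: the lemma "follows directly from [the invariant], using [the definitions of
`λ, q, w`] and the fact that `p = Θ(log w / w)`").
[cite: RossmanServedioTan2015, Lemma 7.1 (p. 16; proof: App. 12, p. 41)] -/
theorem rossmanServedioTan2015_lem71_holds : rossmanServedioTan2015_lem71 := by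
  refine ⟨1 / 64, by norm_num, ?_⟩
  intro m d hd hdc k hk1 hkd
  have hd2 : (2 : ℝ) ≤ d := by exact_mod_cast hd
  -- (0) the regime hypothesis is false for `m ≤ 1` (`log₂ 0 = log₂ 1 = 0`, `x / 0 = 0`)
  have hm2 : 2 ≤ m := by
    rcases Nat.lt_or_ge m 2 with h | h
    · exfalso
      have h0 : (1 : ℝ) / 64 * m / Real.logb 2 m = 0 := by
        interval_cases m <;> simp
      rw [h0] at hdc
      linarith
    · exact h
  have hm2' : (2 : ℝ) ≤ m := by exact_mod_cast hm2
  have hm0 : (0 : ℝ) < m := by linarith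
  have hlogm1 : 1 ≤ Real.logb 2 (m : ℝ) := by
    rw [Real.le_logb_iff_rpow_le one_lt_two hm0, Real.rpow_one]
    exact hm2'
  have hlogpos : 0 < Real.logb 2 (m : ℝ) := by linarith
  -- (1) the regime in product form, and its consequences `m ≥ 128`, `m ≤ 2^{m/128}`
  have hdlog : (d : ℝ) * Real.logb 2 m ≤ m / 64 := by
    have := (le_div_iff₀ hlogpos).mp hdc
    linarith
  have hlog_le : Real.logb 2 (m : ℝ) ≤ m / 128 := by
    have : 2 * Real.logb 2 (m : ℝ) ≤ d * Real.logb 2 m :=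
      mul_le_mul_of_nonneg_right hd2 hlogpos.le
    linarith
  have hm128 : (128 : ℝ) ≤ m := by linarith
  have hm128n : 128 ≤ m := by exact_mod_cast hm128
  have hm4 : 4 ≤ m := le_trans (by norm_num) hm128n
  have hm1 : 1 ≤ m := le_trans (by norm_num) hm128n
  have hmpow : (m : ℝ) ≤ (2 : ℝ) ^ ((m : ℝ) / 128) :=
    (Real.logb_le_iff_le_rpow one_lt_two hm0).mp hlog_le
  -- (2) bookkeeping with powers of two
  have hpow2 : ∀ a b : ℝ, (2 : ℝ) ^ a * (2 : ℝ) ^ b = (2 : ℝ) ^ (a + b) :=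
    fun a b => (Real.rpow_add two_pos a b).symm
  have hmono : ∀ {a b : ℝ}, a ≤ b → (2 : ℝ) ^ a ≤ (2 : ℝ) ^ b :=
    fun h => Real.rpow_le_rpow_of_exponent_le one_le_two h
  have hpos2 : ∀ a : ℝ, 0 < (2 : ℝ) ^ a := fun a => Real.rpow_pos_of_pos two_pos a
  have hquarter : (2 : ℝ) ^ (-(2 : ℝ)) = 1 / 4 := by
    rw [Real.rpow_neg two_pos.le, Real.rpow_two]
    norm_num
  have hq := rstQ_pos m
  -- (3) `λ + q³ ≤ 2^{-19m/16}`
  have hm2pow : (m : ℝ) ^ 2 ≤ (2 : ℝ) ^ ((m : ℝ) / 64) := by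
    calc (m : ℝ) ^ 2 ≤ ((2 : ℝ) ^ ((m : ℝ) / 128)) ^ 2 := pow_le_pow_left₀ hm0.le hmpow 2
      _ = (2 : ℝ) ^ ((m : ℝ) / 64) := by
          rw [← Real.rpow_natCast, ← Real.rpow_mul two_pos.le]
          congr 1
          push_cast
          ring
  have h4pow : (4 : ℝ) ≤ (2 : ℝ) ^ ((m : ℝ) / 64) := by
    calc (4 : ℝ) = (2 : ℝ) ^ (2 : ℝ) := by rw [Real.rpow_two]; norm_num
      _ ≤ (2 : ℝ) ^ ((m : ℝ) / 64) := hmono (by linarith)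
  have hlam : rstLam m ≤ (2 : ℝ) ^ (-(39 : ℝ) * m / 32) := by
    calc rstLam m ≤ 4 * (m : ℝ) ^ 2 * (2 : ℝ) ^ (-(5 * (m : ℝ) / 4)) := rstLam_le m hm4
      _ ≤ (2 : ℝ) ^ ((m : ℝ) / 64) * (2 : ℝ) ^ ((m : ℝ) / 64) * (2 : ℝ) ^ (-(5 * (m : ℝ) / 4)) := by
          apply mul_le_mul_of_nonneg_right _ (hpos2 _).le
          exact mul_le_mul h4pow hm2pow (by positivity) (hpos2 _).le
      _ = (2 : ℝ) ^ (-(39 : ℝ) * m / 32) := by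
          rw [hpow2, hpow2]
          congr 1
          ring
  have hq3 : rstQ m ^ 3 = (2 : ℝ) ^ (-(3 : ℝ) * m / 2) := by
    unfold rstQ
    rw [← Real.rpow_natCast, ← Real.rpow_mul two_pos.le]
    congr 1
    push_cast
    ring
  have hB0 : rstLam m + rstQ m ^ 3 ≤ (2 : ℝ) ^ (-(19 : ℝ) * m / 16) := by
    have h1 : rstQ m ^ 3 ≤ (2 : ℝ) ^ (-(39 : ℝ) * m / 32) := by
      rw [hq3]
      exact hmono (by linarith)
    calc rstLam m + rstQ m ^ 3 ≤ 2 * (2 : ℝ) ^ (-(39 : ℝ) * m / 32) := by linarith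
      _ = (2 : ℝ) ^ (1 + -(39 : ℝ) * m / 32) := by rw [← hpow2, Real.rpow_one]
      _ ≤ (2 : ℝ) ^ (-(19 : ℝ) * m / 16) := hmono (by linarith)
  have hB0nn : 0 ≤ rstLam m + rstQ m ^ 3 := add_nonneg (rstLam_nonneg m) (pow_nonneg hq.le 3)
  -- (4) the regime: `(4m)^{d-2} ≤ 2^{3m/64}`
  have hreg : (4 * (m : ℝ)) ^ (d - 2) ≤ (2 : ℝ) ^ (3 * (m : ℝ) / 64) := by
    have h4m : (2 : ℝ) ^ (Real.logb 2 (4 * m)) = 4 * (m : ℝ) :=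
      Real.rpow_logb two_pos (by norm_num) (by positivity)
    have hlog4 : Real.logb 2 4 = 2 := by
      rw [show (4 : ℝ) = 2 ^ ((2 : ℕ) : ℝ) by rw [Real.rpow_natCast]; norm_num,
        Real.logb_rpow two_pos (by norm_num)]
      norm_num
    have hlog4m : Real.logb 2 (4 * m) ≤ 3 * Real.logb 2 m := by
      rw [Real.logb_mul (by norm_num) hm0.ne', hlog4]
      linarith
    have hJd : ((d - 2 : ℕ) : ℝ) ≤ d := by exact_mod_cast Nat.sub_le d 2
    have h3 : 3 * Real.logb 2 m * d ≤ 3 * (m : ℝ) / 64 := by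
      have := mul_le_mul_of_nonneg_left hdlog (by norm_num : (0 : ℝ) ≤ 3)
      linarith [mul_comm (Real.logb 2 (m : ℝ)) (d : ℝ)]
    calc (4 * (m : ℝ)) ^ (d - 2) = ((2 : ℝ) ^ (Real.logb 2 (4 * m))) ^ (d - 2) := by rw [h4m]
      _ = (2 : ℝ) ^ (Real.logb 2 (4 * m) * ((d - 2 : ℕ) : ℝ)) := by
          rw [← Real.rpow_natCast, ← Real.rpow_mul two_pos.le]
      _ ≤ (2 : ℝ) ^ (3 * (m : ℝ) / 64) := by
          apply hmono
          have : Real.logb 2 (4 * m) * ((d - 2 : ℕ) : ℝ) ≤ 3 * Real.logb 2 m * d :=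
            mul_le_mul hlog4m hJd (Nat.cast_nonneg _) (by linarith)
          linarith
  -- (5) `B := (4m)^{d-2} (λ + q³) ≤ 2^{-73m/64}`, and the hypotheses of the induction
  have hB : (4 * (m : ℝ)) ^ (d - 2) * (rstLam m + rstQ m ^ 3) ≤ (2 : ℝ) ^ (-(73 : ℝ) * m / 64) := by
    calc (4 * (m : ℝ)) ^ (d - 2) * (rstLam m + rstQ m ^ 3)
        ≤ (2 : ℝ) ^ (3 * (m : ℝ) / 64) * (2 : ℝ) ^ (-(19 : ℝ) * m / 16) :=
          mul_le_mul hreg hB0 hB0nn (hpos2 _).le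
      _ = (2 : ℝ) ^ (-(73 : ℝ) * m / 64) := by
          rw [hpow2]
          congr 1
          ring
  have hmq : (m : ℝ) * rstQ m ≤ 1 / 4 := by
    calc (m : ℝ) * rstQ m ≤ (2 : ℝ) ^ ((m : ℝ) / 128) * (2 : ℝ) ^ (-(m : ℝ) / 2) := by
          unfold rstQ
          exact mul_le_mul_of_nonneg_right hmpow (hpos2 _).le
      _ = (2 : ℝ) ^ ((m : ℝ) / 128 + -(m : ℝ) / 2) := hpow2 _ _
      _ ≤ (2 : ℝ) ^ (-(2 : ℝ)) := hmono (by linarith)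
      _ = 1 / 4 := hquarter
  have h2m : (2 : ℝ) ^ m = (2 : ℝ) ^ ((m : ℝ)) := (Real.rpow_natCast 2 m).symm
  have hJ : (4 * (m : ℝ)) ^ (d - 2) * (rstLam m + rstQ m ^ 3) * m * 2 ^ m ≤ 1 / 4 := by
    calc (4 * (m : ℝ)) ^ (d - 2) * (rstLam m + rstQ m ^ 3) * m * 2 ^ m
        ≤ (2 : ℝ) ^ (-(73 : ℝ) * m / 64) * (2 : ℝ) ^ ((m : ℝ) / 128) * (2 : ℝ) ^ ((m : ℝ)) := by
          rw [h2m]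
          apply mul_le_mul_of_nonneg_right _ (hpos2 _).le
          exact mul_le_mul hB hmpow hm0.le (hpos2 _).le
      _ = (2 : ℝ) ^ (-(17 : ℝ) * m / 128) := by
          rw [hpow2, hpow2]
          congr 1
          ring
      _ ≤ (2 : ℝ) ^ (-(2 : ℝ)) := hmono (by linarith)
      _ = 1 / 4 := hquarter
  -- (6) eq. (25): `|t_k q - p| ≤ (4m)^{d-1-k} (λ + q³) ≤ B`
  have hind := rstTAux_mul_rstQ_sub_rstP m (d - 2) hm1 hmq hJ (d - 1 - k) (by omega)
  have ht : |rstT m d k * rstQ m - rstP m| ≤ (2 : ℝ) ^ (-(73 : ℝ) * m / 64) := by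
    unfold rstT
    refine hind.trans (le_trans ?_ hB)
    apply mul_le_mul_of_nonneg_right _ hB0nn
    exact pow_le_pow_right₀ (by linarith) (by omega)
  -- (7) divide by `q`: `|t_k - q| ≤ B / q = B 2^{m/2} ≤ 2^{-0.55 m} = q^{1.1}`
  have habs : |rstT m d k * rstQ m - rstP m| = |rstT m d k - rstQ m| * rstQ m := by
    rw [← rstQ_sq, show rstT m d k * rstQ m - rstQ m ^ 2 = (rstT m d k - rstQ m) * rstQ m by ring,
      abs_mul, abs_of_pos hq]
  have e11 : (1.1 : ℝ) = 11 / 10 := by norm_num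
  calc |rstT m d k - rstQ m| ≤ (2 : ℝ) ^ (-(73 : ℝ) * m / 64) / rstQ m := by
        rw [le_div_iff₀ hq, ← habs]
        exact ht
    _ = (2 : ℝ) ^ (-(73 : ℝ) * m / 64 + (m : ℝ) / 2) := by
        rw [div_eq_iff hq.ne', ← hpow2, mul_assoc]
        unfold rstQ
        rw [hpow2 ((m : ℝ) / 2), show (m : ℝ) / 2 + -(m : ℝ) / 2 = 0 by ring, Real.rpow_zero,
          mul_one]
    _ ≤ (2 : ℝ) ^ (-(m : ℝ) / 2 * (1.1 : ℝ)) := hmono (by rw [e11]; nlinarith)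
    _ = rstQ m ^ (1.1 : ℝ) := by
        unfold rstQ
        rw [← Real.rpow_mul two_pos.le]

end Literature.Computability.Complexity

end
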